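import Literature.NumberTheory.EllipticCurves.ZpExtensionEisensteinSelmerStructureProofs
import Literature.NumberTheory.EllipticCurves.ZpExtensionEisensteinOrdinaryFiltration
import Literature.NumberTheory.EllipticCurves.ZpExtensionUnramifiedProofs
import Literature.NumberTheory.EllipticCurves.GoodReductionUnramifiedProofs
import HarnessLib

/-!
# `T_𝔮/p^k T_𝔮 = E[p^k] ⊗ A_{m,k}(ψ)` is unramified at the good places `v ∤ p`; Howard's `F_𝔮` FOR THE CURVE is a Selmer
# structure in his sense for `Σ = ∞ ∪ S ∪ {v ∣ p}` (theorems only; no definition, no named fact, no instance)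

Topic `NumberTheory/EllipticCurves` (D1 road of cell `pub/bsd-print-x9`; companion of
`ZpExtensionEisensteinSelmerStructure[Proofs]` and `ZpExtensionEisensteinOrdinaryFiltration`).

* `WeierstrassCurve.isUnramifiedAt_eisensteinTwist_torsionGaloisModule` — at a finite place `v ∤ p` of good reduction
  every inertia group `I_𝔓 ≤ Γ_K` (`𝔓 ∣ v`) acts trivially on Howard's `E[p^k] ⊗ A_{m,k}(ψ)`: `I_𝔓 ≤ ker κ` (a
  `ℤ_p`-extension is unramified outside `p`, Washington Prop. 13.2, tree `ZpExtension.inertia_le_kerSubgroup_holds`), so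
  it acts through `1 ⊗ ρ` (`eisensteinTwist_apply_eq_self_of_mem_kerSubgroup`), and `ρ = E[p^k]` is unramified at `v`
  (Néron–Ogg–Shafarevich, Silverman VII.4.1(a), tree `smul_geomTorsion_eq_of_mem_inertia`). This is the pattern of the
  tree's `isUnramifiedAt_twistedTorsionGaloisModule` (unit twists) for the `A_{m,k}`-valued character `ψ`.
* `WeierstrassCurve.isHowardSelmerStructure_eisensteinSelmerStructure` — hence, for a finite set `S` of finite places
  containing every place of bad reduction, every place above `p`, and any ordinary data `Φ`, Howard's level-`k`
  Selmer structure `F_𝔮` of `ZpExtensionEisensteinSelmerStructure` on `E[p^k] ⊗ A_{m,k}(ψ)` is a Selmer structure in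
  Howard's sense (tree `Howard2004.IsHowardSelmerStructure`) for `Σ = ∞ ∪ S` — the `hram` hypothesis of the abstract
  `ZpExtension.isHowardSelmerStructure_eisensteinSelmerStructure` discharged for the curve; and the specialisation
  `…_ordinaryFiltrationAt` to the curve's own ordinary data `Fil_v E[p^k] = E[p^k] ∩ E₁(K̄_v)`.

Theorems only; nothing about Selmer groups or `L`-functions is asserted; no `sorry`. BSD is not proved by any of this.

References: [Howard2004HeegnerKolyvagin] B. Howard, Compositio Math. 140 (2004) — arXiv 1202.6340 Def. 2.1.10 (`Σ(F)`
contains the ramified places of `T`), §3.1; [SilvermanAEC2009] Prop. VII.4.1(a); [Washington1997] Prop. 13.2.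
-/

noncomputable section

open scoped TensorProduct Topology ContRepresentation
open Field IsDedekindDomain NumberField

namespace WeierstrassCurve

open Literature.NumberTheory.EllipticCurves Literature.NumberTheory.GaloisRepresentations

section Unramified

universe u

variable {K : Type u} [Field K] [NumberField K] (W : WeierstrassCurve K) [W.IsElliptic] {p : ℕ} [Fact p.Prime]
  (κ : ZpExtension K p) {m : ℕ} (hm : 1 ≤ m)

/-- **`E[p^k] ⊗ A_{m,k}(ψ)` is unramified at a good place `v ∤ p`**: every `τ ∈ I_𝔓`, `𝔓 ∣ v`, lies in `ker κ`
(Washington 13.2), so acts through `1 ⊗ ρ(τ)`, and `ρ(τ) = 1` on `E[p^k]` (Néron–Ogg–Shafarevich).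
[cite: SilvermanAEC2009, Prop. VII.4.1(a)] [cite: Washington1997, Prop. 13.2] [cite: Howard2004HeegnerKolyvagin, §2.2 (T_𝔮 is unramified outside pN)] -/
theorem isUnramifiedAt_eisensteinTwist_torsionGaloisModule {v : HeightOneSpectrum (𝓞 K)} (hv : W.HasGoodReductionAt v)
    (hpv : ((p : ℕ) : 𝓞 K) ∉ v.asIdeal) (k : ℕ) :
    GaloisRep.IsUnramifiedAt v (κ.eisensteinTwist (W.torsionGaloisModule ((p : ℤ) ^ k)) hm k) := by
  intro 𝔓 h𝔓 τ hτ
  have hτk : τ ∈ κ.kerSubgroup := ZpExtension.inertia_le_kerSubgroup_holds K p κ hpv h𝔓 hτ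
  have hn : ((((p : ℤ) ^ k : ℤ) : 𝓞 K)) ∉ v.asIdeal := fun h ↦ hpv <| by
    rw [Int.cast_pow, Int.cast_natCast] at h
    exact v.isPrime.mem_of_pow_mem k h
  refine LinearMap.ext fun x ↦ ?_
  change κ.eisensteinTwist (W.torsionGaloisModule ((p : ℤ) ^ k)) hm k τ x = x
  exact κ.eisensteinTwist_apply_eq_self_of_mem_kerSubgroup _ hm k hτk
    (fun P ↦ by rw [torsionGaloisModule_apply_apply]; exact W.smul_geomTorsion_eq_of_mem_inertia hv hn h𝔓 hτ P) x

/-- The form with a set `S₀` of finite places outside which `W` has good reduction away from `p`: at every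
`v ∉ S₀`, `v ∤ p`, `E[p^k] ⊗ A_{m,k}(ψ)` is unramified. [cite: SilvermanAEC2009, Prop. VII.4.1(a)] [cite: Washington1997, Prop. 13.2] -/
theorem isUnramifiedAt_eisensteinTwist_torsionGaloisModule_of_not_mem {S₀ : Finset (HeightOneSpectrum (𝓞 K))}
    (hbad : ∀ v : HeightOneSpectrum (𝓞 K), v ∉ S₀ → ((p : ℕ) : 𝓞 K) ∉ v.asIdeal → W.HasGoodReductionAt v)
    {v : HeightOneSpectrum (𝓞 K)} (hvS : v ∉ S₀) (hpv : ((p : ℕ) : 𝓞 K) ∉ v.asIdeal) (k : ℕ) :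
    GaloisRep.IsUnramifiedAt v (κ.eisensteinTwist (W.torsionGaloisModule ((p : ℤ) ^ k)) hm k) :=
  W.isUnramifiedAt_eisensteinTwist_torsionGaloisModule κ hm (hbad v hvS hpv) hpv k

end Unramified

section Howard

/-! ### Howard's `Σ(F)` for the curve (the tree's `Howard2004.IsHowardSelmerStructure` lives in universe `0`) -/

variable {K : Type} [Field K] [NumberField K] (W : WeierstrassCurve K) [W.IsElliptic] {p : ℕ} [Fact p.Prime]
  (κ : ZpExtension K p) {m : ℕ} (hm : 1 ≤ m)
  (t : ∀ k, (W.torsionGaloisModule ((p : ℤ) ^ (k + 1))).toContRepresentation →ⁱL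
    (W.torsionGaloisModule ((p : ℤ) ^ k)).toContRepresentation)
  (S : Finset (HeightOneSpectrum (𝓞 K)))
  (Φ : ∀ v : HeightOneSpectrum (𝓞 K), ((p : ℕ) : 𝓞 K) ∈ v.asIdeal →
    ZpExtension.OrdinaryFiltration (fun k ↦ W.torsionGaloisModule ((p : ℤ) ^ k)) t v)

/-- **Howard's `F_𝔮` on `E[p^k] ⊗ A_{m,k}(ψ)` is a Selmer structure in his sense for `Σ = ∞ ∪ S`** (tree
`Howard2004.IsHowardSelmerStructure`), for any finite set `S` of finite places containing the places above `p` and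
those of bad reduction away from `p`, and any ordinary data `Φ` at `v ∣ p`: unramified outside `Σ` by construction,
`Σ ∋ v ∣ p` by hypothesis, and `Σ` contains the ramified places of the module by
`isUnramifiedAt_eisensteinTwist_torsionGaloisModule`. [cite: Howard2004HeegnerKolyvagin, Def. 1.1.10 (arXiv Def. 2.1.10) and Def. 3.1.2] -/
theorem isHowardSelmerStructure_eisensteinSelmerStructure
    (hp : ∀ v : HeightOneSpectrum (𝓞 K), ((p : ℕ) : 𝓞 K) ∈ v.asIdeal → v ∈ S)
    (hbad : ∀ v : HeightOneSpectrum (𝓞 K), v ∉ S → ((p : ℕ) : 𝓞 K) ∉ v.asIdeal → W.HasGoodReductionAt v) (k : ℕ) :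
    Literature.NumberTheory.GaloisCohomology.Howard2004.IsHowardSelmerStructure p
      (κ.eisensteinSelmerStructure (fun k ↦ W.torsionGaloisModule ((p : ℤ) ^ k)) t hm S Φ k)
      ((Finset.univ : Finset (NumberField.InfinitePlace K)).disjSum S) := by
  have hram : ∀ v : HeightOneSpectrum (𝓞 K),
      ¬ GaloisRep.IsUnramifiedAt v (κ.eisensteinTwist (W.torsionGaloisModule ((p : ℤ) ^ k)) hm k) → v ∈ S := by
    intro v hv
    by_contra hvS
    exact hv (W.isUnramifiedAt_eisensteinTwist_torsionGaloisModule_of_not_mem κ hm hbad hvS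
      (fun h ↦ hvS (hp v h)) k)
  exact κ.isHowardSelmerStructure_eisensteinSelmerStructure (fun k ↦ W.torsionGaloisModule ((p : ℤ) ^ k)) t hm S Φ
    k S (Finset.Subset.refl S) hp hram

variable (ht : ∀ k (P : geomTorsion W ((p : ℤ) ^ (k + 1))), t k P = W.geomTorsionReduce p k P)

/-- **The curve's own `F_𝔮`** — `eisensteinSelmerStructure` with the ordinary data `Fil_v E[p^k] = E[p^k] ∩ E₁(K̄_v)`
(`ordinaryFiltrationAt`) at every `v ∣ p` — is a Howard Selmer structure for `Σ = ∞ ∪ S` (`S ⊇ {v ∣ p} ∪` bad places).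
[cite: Howard2004HeegnerKolyvagin, Def. 1.1.10, Def. 3.1.2 and Def. 3.2.5] -/
theorem isHowardSelmerStructure_eisensteinSelmerStructure_ordinaryFiltrationAt
    (hp : ∀ v : HeightOneSpectrum (𝓞 K), ((p : ℕ) : 𝓞 K) ∈ v.asIdeal → v ∈ S)
    (hbad : ∀ v : HeightOneSpectrum (𝓞 K), v ∉ S → ((p : ℕ) : 𝓞 K) ∉ v.asIdeal → W.HasGoodReductionAt v) (k : ℕ) :
    Literature.NumberTheory.GaloisCohomology.Howard2004.IsHowardSelmerStructure p
      (κ.eisensteinSelmerStructure (fun k ↦ W.torsionGaloisModule ((p : ℤ) ^ k)) t hm S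
        (fun v _ ↦ W.ordinaryFiltrationAt v t ht) k)
      ((Finset.univ : Finset (NumberField.InfinitePlace K)).disjSum S) :=
  W.isHowardSelmerStructure_eisensteinSelmerStructure κ hm t S _ hp hbad k

end Howard

end WeierstrassCurve

end
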